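import Summits.CriticalPhenomena.PercolationContinuityZ3.Theorems.PercNearOneGluingNoHeavyLowerTailTerminalEdgeStepXiHqtLeFive

/-!
# `NoHeavyLowerTail` (crux stmt-CriticalPhenomena-4575, closed): the `H_{q+t}` and AG⁺ terminal-edge Bernstein pieces are FIRST-ORDER
# nonnegative at the cut-vertex stratum `CUT:b:ay|c`, along every elementary attachment direction — by two Harris covariances of the
# HIDDEN attachment vertex (support file, prover seat `prim-l12-p2` gen 3; `--supports stmt-CriticalPhenomena-4575`; pure algebra, `ring`/`positivity`)

Context.  The apex-edge steps (BH1),(BH2) for `H_{q+t}` and (BΞ1),(BΞ2) for AG⁺ (`hqtB₁, hqtB₂, xiB₁, xiB₂` of `…TerminalEdgeStepXiHqtLeFive`,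
census-clean, open beyond five vertices) vanish identically on the four cut-vertex varieties of the 15-cell law of `(a,b,c,y)`; prim-facecert
(2026-08-19) and prim-bnk-1 / this seat (2026-08-20) showed that at generic points of `V3 = CUT:b:ay|c` (the terminal `b` is a cut vertex of the
support separating the apex pair `{a,y}` from `c`) the gradient of each piece is NOT in the cone generated by the gradients of any known family of
valid polynomial rows on that law (Harris, AG/AG⁺/T_inc/SHK3⁺/`H_{q+t}`-IH on all ten 3-point images, all Richards–Sahi cubic rows on group
separations, van den Berg–Häggström–Kahn conditional-association rows, …): exact pseudo-laws exist, so no law-level certificate with a multiplier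
positive there exists.  This file records WHY, as exact algebra on the tree's own cubics.

Setting.  A law `z ∈ V3` is the 1-sum at `b` of a side graph `G₁ ⊇ {a,y,b}` and a side graph `G₂ ⊇ {b,c}` with `γ = P_{G₂}(b ~ c)`; in the ten
Bernstein coordinates `(q,u₁,u₂,u₃,t | α₁,α₂,β₁,β₂,β₃)` of `…XiHqtLeFive` it reads
`z = ((1−α)(1−γ), α(1−γ), 0, (1−α)γ, αγ | η(1−γ), 0, 0, 0, ηγ)` with `α = P_{G₁}(a~b)`, `η = P_{G₁}(y~b, a≁b)`.
The realizable first-order perturbations of `z` leaving `V3` are ε-identifications of a vertex `w ∈ G₁` with a vertex `w′ ∈ G₂`; writing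
`A = P_{G₁}(w~b~a)`, `N = P_{G₁}(w~b, a≁b)`, `M = P_{G₁}(w~a, w≁b)`, `e₁ = P_{G₁}(w~a, w≁b, y~b)`, `e₂ = P_{G₁}(w~y, w≁a, w≁b, a≁b)`,
`e₃ = P_{G₁}(w~y, w≁b, a~b)`, `f₁ = P_{G₁}(w~b, y~b, a≁b)` and `(ρ,κ₁,κ₂) = P_{G₂}(c~w′ only), P(b~w′ only), P(b~w′~c)`, the displacement is
`ε·[ρ·𝒜 + κ₁·ℬ⁰ + κ₂·ℬ¹]` where `(1−γ)ℬ⁰ + γℬ¹` is tangent to `V3`, `F_A := (1−γ)𝒜 + γℬ¹` is "attach `c` to `w`" and `ℬ¹` is "merge `b` with `w`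
inside the `c~b` slice"; their ten coordinates are the explicit affine functions of `ε` appearing below (derived and cross-checked against brute-force
laws of random graphs in the seat memo, exp17/exp18: exact agreement on 144 instances).

Results (pieces `T ∈ {hqtB₁, hqtB₂}` here; the AG⁺ pieces `xiB₁, xiB₂` verbatim in the companion `…CutVertexFirstOrderXi`; both directions `F_A`, `ℬ¹`):
* `T_attach_expansion` / `T_merge_expansion`: `T(z + ε·direction) = ε·Λ + ε²·R₂ + ε³·R₃` with explicit `Λ, R₂, R₃` (`ring`); in particular `T(z) = 0`.
* `T_lamA_eq_cert`: `Λ_A = Σ ℕ·C₁·mono + Σ ℕ·C₂·mono + Σ ℕ·atom·mono` (`ring`), where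
  `C₁ = (1−α)A − αN − αM = Cov_{G₁}(1_{a~b}, 1_{w~a ∨ w~b})` and `C₂ = (1−α−η)(A+f₁+e₁+e₃) − (α+η)(N−f₁) − (α+η)(M−e₁+e₂)` = the same covariance in
  `G₁/{a=y}` — both `≥ 0` by HARRIS on the side graph (increasing events), and the atoms `α, η, 1−α−η, γ, 1−γ, A, N−f₁, f₁, M−e₁, e₁, e₂, e₃ ≥ 0`;
  `Λ_B` is a nonnegative integer combination of atom monomials outright.
* `T_lamA_nonneg`, `T_lamB_nonneg` (over `ℝ`): hence `Λ ≥ 0`; and for the general identification the derivative is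
  `[ρ·Λ_A + (κ₂(1−γ) − γ(κ₁+ρ))·Λ_B]/(1−γ)` with `κ₂(1−γ) − γ(κ₁+ρ) − κ₁ρ = AG` of the `(b,w′,c)` law of `G₂` (`≥ 0`, vdBK) — recorded in the docstrings,
  the division-free combination is `derivative_comb_nonneg`.
What is NOT claimed: anything beyond first order; anything about realizable tangent directions at `V3` other than finite sums of the elementary
identifications above; anything at the apex-cut-vertex strata `V1/V2` (where the law-level dictionary with vdBHK rows already passes the first-order
test).  Informal consequence (memo prim-l12/prim-l12-p2/FINDING-g3-HQT-STEP-HIDDEN-VERTEX.md): the information that carries the `H_{q+t}`/AG⁺ edge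
steps across the cut-vertex face lives on the 4-point law of `(a,y,b,w)` WITH the attachment vertex — invisible to rows on `(a,b,c,y)` — so a proof of
these steps should be sought at 5-point / configuration (switching, comb) level.  Literature: van den Berg–Häggström–Kahn, Random Struct. Alg. 29
(2006) 417–435, Thm 1.1/1.5 (conditional association; used only in the memo's law-level tests, not here).
-/

namespace Summit.CriticalPhenomena.PercolationContinuityZ3.Theorems.TerminalEdgeStep.CutVertexFirstOrder

open Summit.CriticalPhenomena.PercolationContinuityZ3.Theorems.TerminalEdgeStep

section Algebra

variable {R : Type*} [CommRing R]

/-- First-order coefficient `Λ_A` of the `H_{q+t}` first piece `hqtB₁` at `V3 = CUT:b:ay|c` along the attachment direction `F_A` (attach `c` to the side-1 vertex `w`) (explicit cubic; variables as in the module docstring). [this work] -/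
def hqtB₁_lamA (α η γ A N M e₁ e₂ e₃ f₁ : R) : R :=
  -2 * α * η * γ ^ 3 * M - α ^ 2 * γ ^ 3 * e₂ + α ^ 2 * γ ^ 3 * e₁ - 3 * α ^ 2 * γ ^ 3 * M + 6 * α * η * γ ^ 2 * M + 4 * α * η * γ ^ 2 * N + 4 * α * η * γ ^ 2 * A + 2 * α ^ 2 * γ ^ 2 * e₃ + 3 * α ^ 2 * γ ^ 2 * e₂ - α ^ 2 * γ ^ 2 * e₁ + 9 * α ^ 2 * γ ^ 2 * M + 6 * α ^ 2 * γ ^ 2 * N + 6 * α ^ 2 * γ ^ 2 * A - η * γ ^ 2 * M - η * γ ^ 2 * N - 3 * η * γ ^ 2 * A - 2 * α * γ ^ 2 * f₁ - 3 * α * γ ^ 2 * e₃ - α * γ ^ 2 * e₂ - 2 * α * γ ^ 2 * e₁ - 3 * α * γ ^ 2 * M - 3 * α * γ ^ 2 * N - 9 * α * γ ^ 2 * A - 6 * α * η * γ * M - 6 * α * η * γ * N - 6 * α * η * γ * A - 3 * α ^ 2 * γ * e₃ - 3 * α ^ 2 * γ * e₂ - 9 * α ^ 2 * γ * M - 9 *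 α ^ 2 * γ * N - 9 * α ^ 2 * γ * A + γ ^ 2 * f₁ + γ ^ 2 * e₃ + γ ^ 2 * e₁ + 3 * γ ^ 2 * A + 2 * η * γ * M + 2 * η * γ * N + 5 * η * γ * A + 3 * α * γ * f₁ + 5 * α * γ * e₃ + 2 * α * γ * e₂ + 3 * α * γ * e₁ + 6 * α * γ * M + 6 * α * γ * N + 15 * α * γ * A + 2 * α * η * M + 2 * α * η * N + 2 * α * η * A + α ^ 2 * e₃ + α ^ 2 * e₂ + 3 * α ^ 2 * M + 3 * α ^ 2 * N + 3 * α ^ 2 * A - 2 * γ * f₁ - 2 * γ * e₃ - 2 * γ * e₁ - 6 * γ * A - η * M - η * N - 2 * η * A - α * f₁ - 2 * α * e₃ - α * e₂ - α * e₁ - 3 * α * M - 3 * α * N - 6 * α * A + f₁ + e₃ + e₁ + 3 * A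

/-- Second-order coefficient of the same expansion (bookkeeping only). [this work] -/
def hqtB₁_attachR₂ (α η γ A N M e₁ e₂ e₃ f₁ : R) : R :=
  -η * γ ^ 3 * M ^ 2 + 2 * η * γ ^ 3 * A * M + 2 * α * γ ^ 3 * M * f₁ + 2 * α * γ ^ 3 * M * e₃ - 2 * α * γ ^ 3 * M * e₂ + 4 * α * γ ^ 3 * M * e₁ - 3 * α * γ ^ 3 * M ^ 2 + 2 * α * γ ^ 3 * A * e₂ - 2 * α * γ ^ 3 * A * e₁ + 6 * α * γ ^ 3 * A * M + 3 * η * γ ^ 2 * M ^ 2 + 4 * η * γ ^ 2 * N * M + η * γ ^ 2 * N ^ 2 - 2 * η * γ ^ 2 * A * M - η * γ ^ 2 * A ^ 2 - 6 * α * γ ^ 2 * M * f₁ - 2 * α * γ ^ 2 * M * e₃ + 6 * α * γ ^ 2 * M * e₂ - 8 * α * γ ^ 2 * M * e₁ + 9 * α * γ ^ 2 * M ^ 2 - 2 * α * γ ^ 2 * N * f₁ + 4 * α * γ ^ 2 * N * e₂ - 4 * α * γ ^ 2 * N * e₁ + 12 * α * γ ^ 2 * N * M + 3 * α * γ ^ 2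 * N ^ 2 - 2 * α * γ ^ 2 * A * f₁ - 2 * α * γ ^ 2 * A * e₃ - 2 * α * γ ^ 2 * A * e₂ - 6 * α * γ ^ 2 * A * M - 3 * α * γ ^ 2 * A ^ 2 - γ ^ 2 * M * f₁ - 2 * γ ^ 2 * M * e₃ - 2 * γ ^ 2 * M * e₁ - γ ^ 2 * N * f₁ - γ ^ 2 * N * e₃ - γ ^ 2 * N * e₂ - 3 * γ ^ 2 * N * M + 3 * γ ^ 2 * A * f₁ + 2 * γ ^ 2 * A * e₃ - 2 * γ ^ 2 * A * e₂ + 4 * γ ^ 2 * A * e₁ - 6 * γ ^ 2 * A * M - 3 * γ ^ 2 * A * N + 3 * γ ^ 2 * A ^ 2 - 3 * η * γ * M ^ 2 - 6 * η * γ * N * M - 2 * η * γ * N ^ 2 + 2 * η * γ * A ^ 2 + 6 * α * γ * M * f₁ - 6 * α * γ * M * e₂ + 6 * α * γ * M * e₁ - 9 * α * γ * M ^ 2 + 4 * α * γ * N * f₁ - 6 * α * γ * N * e₂ + 6 * α * γ * N * e₁ - 18 * α * γ * N * M - 6 * α * γ * N ^ 2 + 4 * α * γ * A * f₁ + 4 *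 α * γ * A * e₃ + 4 * α * γ * A * e₁ + 6 * α * γ * A ^ 2 + γ * M * f₁ + 3 * γ * M * e₃ + 3 * γ * M * e₁ + 2 * γ * N * f₁ + 2 * γ * N * e₃ + 2 * γ * N * e₂ + 6 * γ * N * M - 6 * γ * A * f₁ - 4 * γ * A * e₃ + 3 * γ * A * e₂ - 7 * γ * A * e₁ + 9 * γ * A * M + 6 * γ * A * N - 6 * γ * A ^ 2 + η * M ^ 2 + 2 * η * N * M + η * N ^ 2 - η * A ^ 2 - 2 * α * M * f₁ + 2 * α * M * e₂ - 2 * α * M * e₁ + 3 * α * M ^ 2 - 2 * α * N * f₁ + 2 * α * N * e₂ - 2 * α * N * e₁ + 6 * α * N * M + 3 * α * N ^ 2 - 2 * α * A * f₁ - 2 * α * A * e₃ - 2 * α * A * e₁ - 3 * α * A ^ 2 - M * e₃ - M * e₁ - N * f₁ - N * e₃ - N * e₂ - 3 * N * M + 3 * A * f₁ + 2 * A * e₃ - A * e₂ + 3 * A * e₁ - 3 * A * M - 3 * A * N + 3 * A ^ 2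

/-- Third-order coefficient of the same expansion (bookkeeping only). [this work] -/
def hqtB₁_attachR₃ (_α _η γ A N M e₁ e₂ e₃ f₁ : R) : R :=
  γ ^ 3 * M ^ 2 * f₁ + γ ^ 3 * M ^ 2 * e₃ + γ ^ 3 * M ^ 2 * e₁ - 2 * γ ^ 3 * A * M * f₁ - 2 * γ ^ 3 * A * M * e₃ + 2 * γ ^ 3 * A * M * e₂ - 4 * γ ^ 3 * A * M * e₁ + 3 * γ ^ 3 * A * M ^ 2 - γ ^ 3 * A ^ 2 * e₂ + γ ^ 3 * A ^ 2 * e₁ - 3 * γ ^ 3 * A ^ 2 * M - 3 * γ ^ 2 * M ^ 2 * f₁ - γ ^ 2 * M ^ 2 * e₃ - γ ^ 2 * M ^ 2 * e₁ - 2 * γ ^ 2 * N * M * f₁ + 4 * γ ^ 2 * N * M * e₂ - 4 * γ ^ 2 * N * M * e₁ + 6 * γ ^ 2 * N * M ^ 2 + γ ^ 2 * N ^ 2 * e₂ - γ ^ 2 * N ^ 2 * e₁ + 3 * γ ^ 2 * N ^ 2 * M + 4 * γ ^ 2 * A * M * f₁ + 4 * γ ^ 2 * A * M * e₃ - 2 *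 γ ^ 2 * A * M * e₂ + 6 * γ ^ 2 * A * M * e₁ - 3 * γ ^ 2 * A * M ^ 2 + 2 * γ ^ 2 * A ^ 2 * e₂ - 2 * γ ^ 2 * A ^ 2 * e₁ + 6 * γ ^ 2 * A ^ 2 * M + 3 * γ * M ^ 2 * f₁ + 4 * γ * N * M * f₁ - 6 * γ * N * M * e₂ + 6 * γ * N * M * e₁ - 9 * γ * N * M ^ 2 - 2 * γ * N ^ 2 * e₂ + 2 * γ * N ^ 2 * e₁ - 6 * γ * N ^ 2 * M - 2 * γ * A * M * f₁ - 2 * γ * A * M * e₃ - 2 * γ * A * M * e₁ - γ * A ^ 2 * e₂ + γ * A ^ 2 * e₁ - 3 * γ * A ^ 2 * M - M ^ 2 * f₁ - 2 * N * M * f₁ + 2 * N * M * e₂ - 2 * N * M * e₁ + 3 * N * M ^ 2 + N ^ 2 * e₂ - N ^ 2 * e₁ + 3 * N ^ 2 * M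

/-- **Expansion of `hqtB₁` at the cut-vertex stratum `V3` along the attachment direction `F_A` (attach `c` to the side-1 vertex `w`)**: the value at `ε = 0` is `0` and the `ε`-coefficient is `hqtB₁_lamA`. [this work] -/
theorem hqtB₁_attach_expansion (α η γ A N M e₁ e₂ e₃ f₁ : R) (ε : R) :
    hqtB₁ (α * γ - γ - α + 1 + ε * (γ * M + γ * N - M - N)) (-α * γ + α + ε * (γ * A - A)) (ε * (-γ * M + M)) (-α * γ + γ + ε * (-γ * M - γ * N + N)) (α * γ + ε * (γ * M - γ * A + A)) (-η * γ + η + ε * (γ * f₁ + γ * e₁ - f₁ - e₁)) (ε * (-γ * e₂ + e₂)) (ε * (-γ * e₃ + e₃)) (ε * (-γ * e₁ + e₁)) (η * γ + ε * (-γ * f₁ + γ * e₂ - γ * e₁ + f₁)) =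
      ε * hqtB₁_lamA α η γ A N M e₁ e₂ e₃ f₁ + ε ^ 2 * hqtB₁_attachR₂ α η γ A N M e₁ e₂ e₃ f₁ + ε ^ 3 * hqtB₁_attachR₃ α η γ A N M e₁ e₂ e₃ f₁ := by
  simp only [hqtB₁, hqtB₁_lamA, hqtB₁_attachR₂, hqtB₁_attachR₃]
  ring

/-- Certificate form of `hqtB₁_lamA`: a nonnegative integer combination of the two Harris covariances `C₁, C₂` and the atoms (`ρ = 1−α−η`, `γ' = 1−γ`, `u = N−f₁`, `v = M−e₁`). [this work] -/
def hqtB₁_certA (α η ρ γ γ' _A _u _f₁ v e₁ e₂ e₃ C₁ C₂ : R) : R :=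
  C₂ * ρ * γ' ^ 3 + C₂ * ρ * γ * γ' ^ 2 + e₃ * η * ρ * γ' ^ 3 + e₂ * η * ρ * γ' ^ 3 + C₂ * η * γ' ^ 3 + e₃ * η * ρ * γ * γ' ^ 2 + e₂ * η * ρ * γ * γ' ^ 2 + e₂ * α * η * γ * γ' ^ 2 + e₃ * η ^ 2 * γ' ^ 3 + e₂ * η ^ 2 * γ' ^ 3 + C₁ * η * γ' ^ 3 + e₃ * η ^ 2 * γ * γ' ^ 2 + e₂ * η ^ 2 * γ * γ' ^ 2 + 2 * C₁ * η * γ * γ' ^ 2 + C₁ * η * γ ^ 2 * γ' + 2 * C₁ * ρ * γ' ^ 3 + 2 * C₁ * ρ * γ * γ' ^ 2 + C₂ * α * γ * γ' ^ 2 + C₂ * α * γ ^ 2 * γ' + e₃ * α * η * γ * γ' ^ 2 + C₂ * η * γ * γ' ^ 2 + 2 * C₁ * α * γ * γ' ^ 2 + e₃ * α * η * γ ^ 2 * γ' + e₂ * α * η * γ ^ 2 * γ' + 2 * e₁ * α * η * γ ^ 2 * γ' + 2 * v * α * η * γ ^ 2 * γ' + 2 * C₁ * α * γ ^ 2 * γ'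 + e₂ * α ^ 2 * γ ^ 2 * γ' + 2 * e₁ * α ^ 2 * γ ^ 2 * γ' + 3 * v * α ^ 2 * γ ^ 2 * γ'

/-- `Λ_A = certificate` with `C₁ = (1−α)A − αN − αM` (`= Cov_{G₁}(1_{a~b}, 1_{w~a∨w~b})`) and `C₂` the same covariance in `G₁/{a=y}`. [this work] -/
theorem hqtB₁_lamA_eq_cert (α η γ A N M e₁ e₂ e₃ f₁ : R) :
    hqtB₁_lamA α η γ A N M e₁ e₂ e₃ f₁ = hqtB₁_certA α η (1 - α - η) γ (1 - γ) A (N - f₁) f₁ (M - e₁) e₁ e₂ e₃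
      ((1 - α) * A - α * N - α * M) ((1 - α - η) * (A + f₁ + e₁ + e₃) - (α + η) * (N - f₁) - (α + η) * (M - e₁ + e₂)) := by
  simp only [hqtB₁_lamA, hqtB₁_certA]
  ring

/-- First-order coefficient `Λ_B` of the `H_{q+t}` first piece `hqtB₁` at `V3 = CUT:b:ay|c` along the merge direction `ℬ¹` (merge `b` with `w` inside the `c ~ b` slice) (explicit cubic; variables as in the module docstring). [this work] -/
def hqtB₁_lamB (α η γ _A _N M e₁ e₂ _e₃ _f₁ : R) : R :=
  -2 * η * γ ^ 2 * M - 2 * α * γ ^ 2 * e₂ + 2 * α * γ ^ 2 * e₁ - 6 * α * γ ^ 2 * M + γ ^ 2 * e₂ - γ ^ 2 * e₁ + 3 * γ ^ 2 * M + 3 * η * γ * M + 3 * α * γ * e₂ - 3 * α * γ * e₁ + 9 * α * γ * M - 2 * γ * e₂ + 2 * γ * e₁ - 6 * γ * M - η * M - α * e₂ + α * e₁ - 3 * α * M + e₂ - e₁ + 3 * M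

/-- Second-order coefficient of the same expansion (bookkeeping only). [this work] -/
def hqtB₁_mergeR₂ (_α _η γ _A _N M e₁ e₂ _e₃ _f₁ : R) : R :=
  -2 * γ * M * e₂ + 2 * γ * M * e₁ - 3 * γ * M ^ 2 + 2 * M * e₂ - 2 * M * e₁ + 3 * M ^ 2

/-- Third-order coefficient of the same expansion (bookkeeping only). [this work] -/
def hqtB₁_mergeR₃ (_α _η _γ _A _N _M _e₁ _e₂ _e₃ _f₁ : R) : R :=
  0

/-- **Expansion of `hqtB₁` at the cut-vertex stratum `V3` along the merge direction `ℬ¹` (merge `b` with `w` inside the `c ~ b` slice)**: the value at `ε = 0` is `0` and the `ε`-coefficient is `hqtB₁_lamB`. [this work] -/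
theorem hqtB₁_merge_expansion (α η γ A N M e₁ e₂ e₃ f₁ : R) (ε : R) :
    hqtB₁ (α * γ - γ - α + 1 + ε * (0)) (-α * γ + α + ε * (0)) (ε * (0)) (-α * γ + γ + ε * (-M)) (α * γ + ε * (M)) (-η * γ + η + ε * (0)) (ε * (0)) (ε * (0)) (ε * (0)) (η * γ + ε * (e₂ - e₁)) =
      ε * hqtB₁_lamB α η γ A N M e₁ e₂ e₃ f₁ + ε ^ 2 * hqtB₁_mergeR₂ α η γ A N M e₁ e₂ e₃ f₁ + ε ^ 3 * hqtB₁_mergeR₃ α η γ A N M e₁ e₂ e₃ f₁ := by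
  simp only [hqtB₁, hqtB₁_lamB, hqtB₁_mergeR₂, hqtB₁_mergeR₃]
  ring

/-- Certificate form of `hqtB₁_lamB`: a nonnegative integer combination of atom monomials (`ρ = 1−α−η`, `γ' = 1−γ`, `u = N−f₁`, `v = M−e₁`). [this work] -/
def hqtB₁_certB (α η ρ γ γ' _A _u _f₁ v e₁ e₂ _e₃ : R) : R :=
  e₂ * ρ ^ 2 * γ' ^ 2 + 2 * e₁ * ρ ^ 2 * γ' ^ 2 + 3 * v * ρ ^ 2 * γ' ^ 2 + 2 * e₂ * η * ρ * γ' ^ 2 + 3 * e₁ * η * ρ * γ' ^ 2 + 5 * v * η * ρ * γ' ^ 2 + e₁ * η * ρ * γ * γ' + v * η * ρ * γ * γ' + e₂ * η ^ 2 * γ' ^ 2 + e₁ * η ^ 2 * γ' ^ 2 + 2 * v * η ^ 2 * γ' ^ 2 + e₁ * η ^ 2 * γ * γ' + v * η ^ 2 * γ * γ' + e₂ * α * ρ * γ' ^ 2 + 2 * e₁ * α * ρ * γ' ^ 2 + 3 * v * α * ρ * γ' ^ 2 + e₂ * α * ρ * γ * γ' + 2 * e₁ * α * ρ * γ * γ'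 + 3 * v * α * ρ * γ * γ' + e₂ * α * η * γ' ^ 2 + e₁ * α * η * γ' ^ 2 + 2 * v * α * η * γ' ^ 2 + e₂ * α * η * γ * γ' + 3 * e₁ * α * η * γ * γ' + 4 * v * α * η * γ * γ' + e₂ * α ^ 2 * γ * γ' + 2 * e₁ * α ^ 2 * γ * γ' + 3 * v * α ^ 2 * γ * γ'

/-- `Λ_B = certificate`. [this work] -/
theorem hqtB₁_lamB_eq_cert (α η γ A N M e₁ e₂ e₃ f₁ : R) :
    hqtB₁_lamB α η γ A N M e₁ e₂ e₃ f₁ = hqtB₁_certB α η (1 - α - η) γ (1 - γ) A (N - f₁) f₁ (M - e₁) e₁ e₂ e₃ := by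
  simp only [hqtB₁_lamB, hqtB₁_certB]
  ring

/-- First-order coefficient `Λ_A` of the `H_{q+t}` second piece `hqtB₂` at `V3 = CUT:b:ay|c` along the attachment direction `F_A` (attach `c` to the side-1 vertex `w`) (explicit cubic; variables as in the module docstring). [this work] -/
def hqtB₂_lamA (α η γ A N M e₁ e₂ e₃ f₁ : R) : R :=
  -η ^ 2 * γ ^ 3 * M - 2 * α * η * γ ^ 3 * e₂ + 2 * α * η * γ ^ 3 * e₁ - 4 * α * η * γ ^ 3 * M - 2 * α ^ 2 * γ ^ 3 * e₂ + 2 * α ^ 2 * γ ^ 3 * e₁ - 3 * α ^ 2 * γ ^ 3 * M + 3 * η ^ 2 * γ ^ 2 * M + 2 * η ^ 2 * γ ^ 2 * N + 2 * η ^ 2 * γ ^ 2 * A + 4 * α * η * γ ^ 2 * e₃ + 6 * α * η * γ ^ 2 * e₂ - 2 * α * η * γ ^ 2 * e₁ + 12 * α * η * γ ^ 2 * M + 8 * α * η * γ ^ 2 * N + 8 * α * η * γ ^ 2 * A + 4 * α ^ 2 * γ ^ 2 * e₃ + 6 * α ^ 2 * γ ^ 2 * e₂ - 2 * α ^ 2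 * γ ^ 2 * e₁ + 9 * α ^ 2 * γ ^ 2 * M + 6 * α ^ 2 * γ ^ 2 * N + 6 * α ^ 2 * γ ^ 2 * A - 2 * η * γ ^ 2 * f₁ - 3 * η * γ ^ 2 * e₃ - η * γ ^ 2 * e₂ - 2 * η * γ ^ 2 * e₁ - 2 * η * γ ^ 2 * M - 2 * η * γ ^ 2 * N - 6 * η * γ ^ 2 * A - 3 * η ^ 2 * γ * M - 3 * η ^ 2 * γ * N - 3 * η ^ 2 * γ * A - 4 * α * γ ^ 2 * f₁ - 6 * α * γ ^ 2 * e₃ - 2 * α * γ ^ 2 * e₂ - 4 * α * γ ^ 2 * e₁ - 3 * α * γ ^ 2 * M - 3 * α * γ ^ 2 * N - 9 * α * γ ^ 2 * A - 6 * α * η * γ * e₃ - 6 * α * η * γ * e₂ - 12 * α * η * γ * M - 12 * α * η * γ * N - 12 * α * η * γ * A - 6 * α ^ 2 * γ * e₃ - 6 * α ^ 2 * γ * e₂ - 9 * α ^ 2 * γ * M - 9 * α ^ 2 * γ * N - 9 * α ^ 2 * γ * A + 2 * γ ^ 2 * f₁ + 2 * γ ^ 2 * e₃ + 2 * γ ^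 2 * e₁ + 3 * γ ^ 2 * A + 3 * η * γ * f₁ + 5 * η * γ * e₃ + 2 * η * γ * e₂ + 3 * η * γ * e₁ + 4 * η * γ * M + 4 * η * γ * N + 10 * η * γ * A + η ^ 2 * M + η ^ 2 * N + η ^ 2 * A + 6 * α * γ * f₁ + 10 * α * γ * e₃ + 4 * α * γ * e₂ + 6 * α * γ * e₁ + 6 * α * γ * M + 6 * α * γ * N + 15 * α * γ * A + 2 * α * η * e₃ + 2 * α * η * e₂ + 4 * α * η * M + 4 * α * η * N + 4 * α * η * A + 2 * α ^ 2 * e₃ + 2 * α ^ 2 * e₂ + 3 * α ^ 2 * M + 3 * α ^ 2 * N + 3 * α ^ 2 * A - 4 * γ * f₁ - 4 * γ * e₃ - 4 * γ * e₁ - 6 * γ * A - η * f₁ - 2 * η * e₃ - η * e₂ - η * e₁ - 2 * η * M - 2 * η * N - 4 * η * A - 2 * α * f₁ - 4 * α * e₃ - 2 * α * e₂ - 2 * α * e₁ - 3 * α * M - 3 * α * N - 6 * α * A + 2 * f₁ + 2 * e₃ + 2 * e₁ + 3 * A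

set_option maxHeartbeats 400000 in
/-- Second-order coefficient of the same expansion (bookkeeping only). [this work] -/
def hqtB₂_attachR₂ (α η γ A N M e₁ e₂ e₃ f₁ : R) : R :=
  2 * η * γ ^ 3 * M * f₁ + 2 * η * γ ^ 3 * M * e₃ - 2 * η * γ ^ 3 * M * e₂ + 4 * η * γ ^ 3 * M * e₁ - 2 * η * γ ^ 3 * M ^ 2 + 2 * η * γ ^ 3 * A * e₂ - 2 * η * γ ^ 3 * A * e₁ + 4 * η * γ ^ 3 * A * M + 2 * α * γ ^ 3 * e₂ * f₁ + 2 * α * γ ^ 3 * e₂ * e₃ - α * γ ^ 3 * e₂ ^ 2 - 2 * α * γ ^ 3 * e₁ * f₁ - 2 * α * γ ^ 3 * e₁ * e₃ + 4 * α * γ ^ 3 * e₁ * e₂ - 3 * α * γ ^ 3 * e₁ ^ 2 + 4 * α * γ ^ 3 * M * f₁ + 4 * α * γ ^ 3 * M * e₃ - 4 * α * γ ^ 3 * M * e₂ + 8 * α * γ ^ 3 * M * e₁ - 3 * α * γ ^ 3 * M ^ 2 + 4 * α * γ ^ 3 * A * e₂ - 4 * α * γ ^ 3 * A * e₁ + 6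 * α * γ ^ 3 * A * M - 6 * η * γ ^ 2 * M * f₁ - 2 * η * γ ^ 2 * M * e₃ + 6 * η * γ ^ 2 * M * e₂ - 8 * η * γ ^ 2 * M * e₁ + 6 * η * γ ^ 2 * M ^ 2 - 2 * η * γ ^ 2 * N * f₁ + 4 * η * γ ^ 2 * N * e₂ - 4 * η * γ ^ 2 * N * e₁ + 8 * η * γ ^ 2 * N * M + 2 * η * γ ^ 2 * N ^ 2 - 2 * η * γ ^ 2 * A * f₁ - 2 * η * γ ^ 2 * A * e₃ - 2 * η * γ ^ 2 * A * e₂ - 4 * η * γ ^ 2 * A * M - 2 * η * γ ^ 2 * A ^ 2 - 2 * α * γ ^ 2 * e₃ * f₁ - α * γ ^ 2 * e₃ ^ 2 - 6 * α * γ ^ 2 * e₂ * f₁ - 2 * α * γ ^ 2 * e₂ * e₃ + 3 * α * γ ^ 2 * e₂ ^ 2 + 4 * α * γ ^ 2 * e₁ * f₁ - 8 * α * γ ^ 2 * e₁ * e₂ + 4 * α * γ ^ 2 * e₁ ^ 2 - 12 * α * γ ^ 2 * M * f₁ - 4 * α * γ ^ 2 * M * e₃ + 12 * α * γ ^ 2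 * M * e₂ - 16 * α * γ ^ 2 * M * e₁ + 9 * α * γ ^ 2 * M ^ 2 - 4 * α * γ ^ 2 * N * f₁ + 8 * α * γ ^ 2 * N * e₂ - 8 * α * γ ^ 2 * N * e₁ + 12 * α * γ ^ 2 * N * M + 3 * α * γ ^ 2 * N ^ 2 - 4 * α * γ ^ 2 * A * f₁ - 4 * α * γ ^ 2 * A * e₃ - 4 * α * γ ^ 2 * A * e₂ - 6 * α * γ ^ 2 * A * M - 3 * α * γ ^ 2 * A ^ 2 + 2 * γ ^ 2 * f₁ ^ 2 + 3 * γ ^ 2 * e₃ * f₁ + γ ^ 2 * e₃ ^ 2 - γ ^ 2 * e₂ * f₁ - 2 * γ ^ 2 * e₂ * e₃ + 4 * γ ^ 2 * e₁ * f₁ + 4 * γ ^ 2 * e₁ * e₃ - 2 * γ ^ 2 * e₁ * e₂ + 3 * γ ^ 2 * e₁ ^ 2 - 2 * γ ^ 2 * M * f₁ - 4 * γ ^ 2 * M * e₃ - 4 * γ ^ 2 * M * e₁ - 2 * γ ^ 2 * N * f₁ - 2 * γ ^ 2 * N * e₃ - 2 * γ ^ 2 * N * e₂ - 3 * γ ^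 2 * N * M + 6 * γ ^ 2 * A * f₁ + 4 * γ ^ 2 * A * e₃ - 4 * γ ^ 2 * A * e₂ + 8 * γ ^ 2 * A * e₁ - 6 * γ ^ 2 * A * M - 3 * γ ^ 2 * A * N + 3 * γ ^ 2 * A ^ 2 + 6 * η * γ * M * f₁ - 6 * η * γ * M * e₂ + 6 * η * γ * M * e₁ - 6 * η * γ * M ^ 2 + 4 * η * γ * N * f₁ - 6 * η * γ * N * e₂ + 6 * η * γ * N * e₁ - 12 * η * γ * N * M - 4 * η * γ * N ^ 2 + 4 * η * γ * A * f₁ + 4 * η * γ * A * e₃ + 4 * η * γ * A * e₁ + 4 * η * γ * A ^ 2 + 4 * α * γ * e₃ * f₁ + 2 * α * γ * e₃ ^ 2 + 6 * α * γ * e₂ * f₁ - 3 * α * γ * e₂ ^ 2 - 2 * α * γ * e₁ * f₁ + 4 * α * γ * e₁ * e₃ + 6 * α * γ * e₁ * e₂ - α * γ * e₁ ^ 2 + 12 * α * γ * M * f₁ - 12 * α * γ * M * e₂ + 12 * α * γ * M * e₁ - 9 * α * γ * M ^ 2 + 8 * α * γ * N * f₁ - 12 * α * γ * N * e₂ + 12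 * α * γ * N * e₁ - 18 * α * γ * N * M - 6 * α * γ * N ^ 2 + 8 * α * γ * A * f₁ + 8 * α * γ * A * e₃ + 8 * α * γ * A * e₁ + 6 * α * γ * A ^ 2 - 4 * γ * f₁ ^ 2 - 6 * γ * e₃ * f₁ - 2 * γ * e₃ ^ 2 + γ * e₂ * f₁ + 3 * γ * e₂ * e₃ - 7 * γ * e₁ * f₁ - 7 * γ * e₁ * e₃ + 3 * γ * e₁ * e₂ - 5 * γ * e₁ ^ 2 + 2 * γ * M * f₁ + 6 * γ * M * e₃ + 6 * γ * M * e₁ + 4 * γ * N * f₁ + 4 * γ * N * e₃ + 4 * γ * N * e₂ + 6 * γ * N * M - 12 * γ * A * f₁ - 8 * γ * A * e₃ + 6 * γ * A * e₂ - 14 * γ * A * e₁ + 9 * γ * A * M + 6 * γ * A * N - 6 * γ * A ^ 2 - 2 * η * M * f₁ + 2 * η * M * e₂ - 2 * η * M * e₁ + 2 * η * M ^ 2 - 2 * η * N * f₁ + 2 * η * N * e₂ - 2 * η * N * e₁ + 4 * η * N * M + 2 * η * N ^ 2 - 2 * η * A * f₁ - 2 * η * A * e₃ - 2 * η * A * e₁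 - 2 * η * A ^ 2 - 2 * α * e₃ * f₁ - α * e₃ ^ 2 - 2 * α * e₂ * f₁ + α * e₂ ^ 2 - 2 * α * e₁ * e₃ - 2 * α * e₁ * e₂ - 4 * α * M * f₁ + 4 * α * M * e₂ - 4 * α * M * e₁ + 3 * α * M ^ 2 - 4 * α * N * f₁ + 4 * α * N * e₂ - 4 * α * N * e₁ + 6 * α * N * M + 3 * α * N ^ 2 - 4 * α * A * f₁ - 4 * α * A * e₃ - 4 * α * A * e₁ - 3 * α * A ^ 2 + 2 * f₁ ^ 2 + 3 * e₃ * f₁ + e₃ ^ 2 - e₂ * e₃ + 3 * e₁ * f₁ + 3 * e₁ * e₃ - e₁ * e₂ + 2 * e₁ ^ 2 - 2 * M * e₃ - 2 * M * e₁ - 2 * N * f₁ - 2 * N * e₃ - 2 * N * e₂ - 3 * N * M + 6 * A * f₁ + 4 * A * e₃ - 2 * A * e₂ + 6 * A * e₁ - 3 * A * M - 3 * A * N + 3 * A ^ 2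

/-- Third-order coefficient of the same expansion (bookkeeping only). [this work] -/
def hqtB₂_attachR₃ (_α _η γ A N M e₁ e₂ e₃ f₁ : R) : R :=
  -γ ^ 3 * M * f₁ ^ 2 - 2 * γ ^ 3 * M * e₃ * f₁ - γ ^ 3 * M * e₃ ^ 2 + 2 * γ ^ 3 * M * e₂ * f₁ + 2 * γ ^ 3 * M * e₂ * e₃ - 4 * γ ^ 3 * M * e₁ * f₁ - 4 * γ ^ 3 * M * e₁ * e₃ + 2 * γ ^ 3 * M * e₁ * e₂ - 3 * γ ^ 3 * M * e₁ ^ 2 + 2 * γ ^ 3 * M ^ 2 * f₁ + 2 * γ ^ 3 * M ^ 2 * e₃ + 2 * γ ^ 3 * M ^ 2 * e₁ - 2 * γ ^ 3 * A * e₂ * f₁ - 2 * γ ^ 3 * A * e₂ * e₃ + γ ^ 3 * A * e₂ ^ 2 + 2 * γ ^ 3 * A * e₁ * f₁ + 2 * γ ^ 3 * A * e₁ * e₃ - 4 * γ ^ 3 * A * e₁ * e₂ + 3 * γ ^ 3 * A * e₁ ^ 2 - 4 * γ ^ 3 * A * M * f₁ - 4 * γ ^ 3 * A * M * e₃ + 4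 * γ ^ 3 * A * M * e₂ - 8 * γ ^ 3 * A * M * e₁ + 3 * γ ^ 3 * A * M ^ 2 - 2 * γ ^ 3 * A ^ 2 * e₂ + 2 * γ ^ 3 * A ^ 2 * e₁ - 3 * γ ^ 3 * A ^ 2 * M + 3 * γ ^ 2 * M * f₁ ^ 2 + 4 * γ ^ 2 * M * e₃ * f₁ + 2 * γ ^ 2 * M * e₃ ^ 2 - 6 * γ ^ 2 * M * e₂ * f₁ - 2 * γ ^ 2 * M * e₂ * e₃ + 10 * γ ^ 2 * M * e₁ * f₁ + 6 * γ ^ 2 * M * e₁ * e₃ - 2 * γ ^ 2 * M * e₁ * e₂ + 4 * γ ^ 2 * M * e₁ ^ 2 - 6 * γ ^ 2 * M ^ 2 * f₁ - 2 * γ ^ 2 * M ^ 2 * e₃ - 2 * γ ^ 2 * M ^ 2 * e₁ - 2 * γ ^ 2 * N * e₂ * f₁ + 2 * γ ^ 2 * N * e₂ ^ 2 + 2 * γ ^ 2 * N * e₁ * f₁ - 4 * γ ^ 2 * N * e₁ * e₂ + 2 * γ ^ 2 * N * e₁ ^ 2 - 4 * γ ^ 2 * N * M * f₁ + 8 * γ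 ^ 2 * N * M * e₂ - 8 * γ ^ 2 * N * M * e₁ + 6 * γ ^ 2 * N * M ^ 2 + 2 * γ ^ 2 * N ^ 2 * e₂ - 2 * γ ^ 2 * N ^ 2 * e₁ + 3 * γ ^ 2 * N ^ 2 * M + 4 * γ ^ 2 * A * e₂ * f₁ + 4 * γ ^ 2 * A * e₂ * e₃ - γ ^ 2 * A * e₂ ^ 2 - 4 * γ ^ 2 * A * e₁ * f₁ - 4 * γ ^ 2 * A * e₁ * e₃ + 6 * γ ^ 2 * A * e₁ * e₂ - 5 * γ ^ 2 * A * e₁ ^ 2 + 8 * γ ^ 2 * A * M * f₁ + 8 * γ ^ 2 * A * M * e₃ - 4 * γ ^ 2 * A * M * e₂ + 12 * γ ^ 2 * A * M * e₁ - 3 * γ ^ 2 * A * M ^ 2 + 4 * γ ^ 2 * A ^ 2 * e₂ - 4 * γ ^ 2 * A ^ 2 * e₁ + 6 * γ ^ 2 * A ^ 2 * M - 3 * γ * M * f₁ ^ 2 - 2 * γ * M * e₃ * f₁ - γ * M * e₃ ^ 2 + 6 * γ * M * e₂ * f₁ - 8 * γ * M * e₁ * f₁ - 2 * γ * M * e₁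 * e₃ - γ * M * e₁ ^ 2 + 6 * γ * M ^ 2 * f₁ + 4 * γ * N * e₂ * f₁ - 3 * γ * N * e₂ ^ 2 - 4 * γ * N * e₁ * f₁ + 6 * γ * N * e₁ * e₂ - 3 * γ * N * e₁ ^ 2 + 8 * γ * N * M * f₁ - 12 * γ * N * M * e₂ + 12 * γ * N * M * e₁ - 9 * γ * N * M ^ 2 - 4 * γ * N ^ 2 * e₂ + 4 * γ * N ^ 2 * e₁ - 6 * γ * N ^ 2 * M - 2 * γ * A * e₂ * f₁ - 2 * γ * A * e₂ * e₃ + 2 * γ * A * e₁ * f₁ + 2 * γ * A * e₁ * e₃ - 2 * γ * A * e₁ * e₂ + 2 * γ * A * e₁ ^ 2 - 4 * γ * A * M * f₁ - 4 * γ * A * M * e₃ - 4 * γ * A * M * e₁ - 2 * γ * A ^ 2 * e₂ + 2 * γ * A ^ 2 * e₁ - 3 * γ * A ^ 2 * M + M * f₁ ^ 2 - 2 * M * e₂ * f₁ + 2 * M * e₁ * f₁ - 2 * M ^ 2 * f₁ - 2 * N * e₂ * f₁ + N * e₂ ^ 2 + 2 * N * e₁ * f₁ - 2 * N * e₁ *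 e₂ + N * e₁ ^ 2 - 4 * N * M * f₁ + 4 * N * M * e₂ - 4 * N * M * e₁ + 3 * N * M ^ 2 + 2 * N ^ 2 * e₂ - 2 * N ^ 2 * e₁ + 3 * N ^ 2 * M

/-- **Expansion of `hqtB₂` at the cut-vertex stratum `V3` along the attachment direction `F_A` (attach `c` to the side-1 vertex `w`)**: the value at `ε = 0` is `0` and the `ε`-coefficient is `hqtB₂_lamA`. [this work] -/
theorem hqtB₂_attach_expansion (α η γ A N M e₁ e₂ e₃ f₁ : R) (ε : R) :
    hqtB₂ (α * γ - γ - α + 1 + ε * (γ * M + γ * N - M - N)) (-α * γ + α + ε * (γ * A - A)) (ε * (-γ * M + M)) (-α * γ + γ + ε * (-γ * M - γ * N + N)) (α * γ + ε * (γ * M - γ * A + A)) (-η * γ + η + ε * (γ * f₁ + γ * e₁ - f₁ - e₁)) (ε * (-γ * e₂ + e₂)) (ε * (-γ * e₃ + e₃)) (ε * (-γ * e₁ + e₁)) (η * γ + ε * (-γ * f₁ + γ * e₂ - γ * e₁ + f₁)) =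
      ε * hqtB₂_lamA α η γ A N M e₁ e₂ e₃ f₁ + ε ^ 2 * hqtB₂_attachR₂ α η γ A N M e₁ e₂ e₃ f₁ + ε ^ 3 * hqtB₂_attachR₃ α η γ A N M e₁ e₂ e₃ f₁ := by
  simp only [hqtB₂, hqtB₂_lamA, hqtB₂_attachR₂, hqtB₂_attachR₃]
  ring

/-- Certificate form of `hqtB₂_lamA`: a nonnegative integer combination of the two Harris covariances `C₁, C₂` and the atoms (`ρ = 1−α−η`, `γ' = 1−γ`, `u = N−f₁`, `v = M−e₁`). [this work] -/
def hqtB₂_certA (α η ρ γ γ' _A _u _f₁ v e₁ e₂ e₃ C₁ C₂ : R) : R :=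
  e₂ * η * ρ * γ' ^ 3 + e₂ * η * ρ * γ * γ' ^ 2 + e₃ * η * ρ * γ' ^ 3 + 2 * C₂ * ρ * γ' ^ 3 + C₂ * η * γ' ^ 3 + e₃ * η * ρ * γ * γ' ^ 2 + 2 * C₂ * ρ * γ * γ' ^ 2 + C₁ * ρ * γ * γ' ^ 2 + C₂ * η * γ ^ 2 * γ' + e₃ * η ^ 2 * γ * γ' ^ 2 + 2 * C₂ * η * γ * γ' ^ 2 + C₁ * η * γ * γ' ^ 2 + e₃ * η ^ 2 * γ ^ 2 * γ' + e₂ * η ^ 2 * γ ^ 2 * γ' + e₁ * η ^ 2 * γ ^ 2 * γ' + v * η ^ 2 * γ ^ 2 * γ' + C₁ * η * γ ^ 2 * γ' + C₁ * ρ * γ' ^ 3 + e₂ * α * η * γ * γ' ^ 2 + 2 * C₂ * α * γ * γ' ^ 2 + 2 * C₂ * α * γ ^ 2 * γ' + e₃ * α * η * γ * γ' ^ 2 + e₂ * η ^ 2 * γ * γ' ^ 2 + C₁ * α * γ * γ' ^ 2 + e₃ * α * η * γ ^ 2 * γ' + 3 * e₂ * α * η * γ ^ 2 * γ' + 2 *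 e₁ * α * η * γ ^ 2 * γ' + 4 * v * α * η * γ ^ 2 * γ' + C₁ * α * γ ^ 2 * γ' + 2 * e₂ * α ^ 2 * γ ^ 2 * γ' + e₁ * α ^ 2 * γ ^ 2 * γ' + 3 * v * α ^ 2 * γ ^ 2 * γ'

/-- `Λ_A = certificate` with `C₁ = (1−α)A − αN − αM` (`= Cov_{G₁}(1_{a~b}, 1_{w~a∨w~b})`) and `C₂` the same covariance in `G₁/{a=y}`. [this work] -/
theorem hqtB₂_lamA_eq_cert (α η γ A N M e₁ e₂ e₃ f₁ : R) :
    hqtB₂_lamA α η γ A N M e₁ e₂ e₃ f₁ = hqtB₂_certA α η (1 - α - η) γ (1 - γ) A (N - f₁) f₁ (M - e₁) e₁ e₂ e₃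
      ((1 - α) * A - α * N - α * M) ((1 - α - η) * (A + f₁ + e₁ + e₃) - (α + η) * (N - f₁) - (α + η) * (M - e₁ + e₂)) := by
  simp only [hqtB₂_lamA, hqtB₂_certA]
  ring

/-- First-order coefficient `Λ_B` of the `H_{q+t}` second piece `hqtB₂` at `V3 = CUT:b:ay|c` along the merge direction `ℬ¹` (merge `b` with `w` inside the `c ~ b` slice) (explicit cubic; variables as in the module docstring). [this work] -/
def hqtB₂_lamB (α η γ _A _N M e₁ e₂ _e₃ _f₁ : R) : R :=
  -2 * η * γ ^ 2 * e₂ + 2 * η * γ ^ 2 * e₁ - 4 * η * γ ^ 2 * M - 4 * α * γ ^ 2 * e₂ + 4 * α * γ ^ 2 * e₁ - 6 * α * γ ^ 2 * M + 2 * γ ^ 2 * e₂ - 2 * γ ^ 2 * e₁ + 3 * γ ^ 2 * M + 3 * η * γ * e₂ - 3 * η * γ * e₁ + 6 * η * γ * M + 6 * α * γ * e₂ - 6 * α * γ * e₁ + 9 * α * γ * M - 4 * γ * e₂ + 4 * γ * e₁ - 6 * γ * M - η * e₂ + η * e₁ - 2 * η * M - 2 * α * e₂ + 2 * α * e₁ -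 3 * α * M + 2 * e₂ - 2 * e₁ + 3 * M

/-- Second-order coefficient of the same expansion (bookkeeping only). [this work] -/
def hqtB₂_mergeR₂ (_α _η γ _A _N M e₁ e₂ _e₃ _f₁ : R) : R :=
  -γ * e₂ ^ 2 + 2 * γ * e₁ * e₂ - γ * e₁ ^ 2 - 4 * γ * M * e₂ + 4 * γ * M * e₁ - 3 * γ * M ^ 2 + e₂ ^ 2 - 2 * e₁ * e₂ + e₁ ^ 2 + 4 * M * e₂ - 4 * M * e₁ + 3 * M ^ 2

/-- Third-order coefficient of the same expansion (bookkeeping only). [this work] -/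
def hqtB₂_mergeR₃ (_α _η _γ _A _N _M _e₁ _e₂ _e₃ _f₁ : R) : R :=
  0

/-- **Expansion of `hqtB₂` at the cut-vertex stratum `V3` along the merge direction `ℬ¹` (merge `b` with `w` inside the `c ~ b` slice)**: the value at `ε = 0` is `0` and the `ε`-coefficient is `hqtB₂_lamB`. [this work] -/
theorem hqtB₂_merge_expansion (α η γ A N M e₁ e₂ e₃ f₁ : R) (ε : R) :
    hqtB₂ (α * γ - γ - α + 1 + ε * (0)) (-α * γ + α + ε * (0)) (ε * (0)) (-α * γ + γ + ε * (-M)) (α * γ + ε * (M)) (-η * γ + η + ε * (0)) (ε * (0)) (ε * (0)) (ε * (0)) (η * γ + ε * (e₂ - e₁)) =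
      ε * hqtB₂_lamB α η γ A N M e₁ e₂ e₃ f₁ + ε ^ 2 * hqtB₂_mergeR₂ α η γ A N M e₁ e₂ e₃ f₁ + ε ^ 3 * hqtB₂_mergeR₃ α η γ A N M e₁ e₂ e₃ f₁ := by
  simp only [hqtB₂, hqtB₂_lamB, hqtB₂_mergeR₂, hqtB₂_mergeR₃]
  ring

/-- Certificate form of `hqtB₂_lamB`: a nonnegative integer combination of atom monomials (`ρ = 1−α−η`, `γ' = 1−γ`, `u = N−f₁`, `v = M−e₁`). [this work] -/
def hqtB₂_certB (α η ρ γ γ' _A _u _f₁ v e₁ e₂ _e₃ : R) : R :=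
  2 * e₂ * ρ ^ 2 * γ' ^ 2 + e₁ * ρ ^ 2 * γ' ^ 2 + 3 * v * ρ ^ 2 * γ' ^ 2 + 3 * e₂ * η * ρ * γ' ^ 2 + e₁ * η * ρ * γ' ^ 2 + 4 * v * η * ρ * γ' ^ 2 + e₂ * η * ρ * γ * γ' + e₁ * η * ρ * γ * γ' + 2 * v * η * ρ * γ * γ' + e₂ * η ^ 2 * γ' ^ 2 + v * η ^ 2 * γ' ^ 2 + e₂ * η ^ 2 * γ * γ' + e₁ * η ^ 2 * γ * γ' + 2 * v * η ^ 2 * γ * γ' + 2 * e₂ * α * ρ * γ' ^ 2 + e₁ * α * ρ * γ' ^ 2 + 3 * v * α * ρ * γ' ^ 2 + 2 * e₂ * α * ρ * γ * γ' + e₁ * α * ρ * γ * γ' + 3 * v * α * ρ * γ * γ' + e₂ * α * η * γ' ^ 2 + v * α * η * γ' ^ 2 + 3 * e₂ * α * η * γ * γ' + 2 * e₁ * α * η * γ * γ' + 5 * v * α * η * γ * γ' + 2 * e₂ * α ^ 2 * γ * γ' + e₁ * α ^ 2 * γ * γ' + 3 * v * α ^ 2 * γ * γ'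

/-- `Λ_B = certificate`. [this work] -/
theorem hqtB₂_lamB_eq_cert (α η γ A N M e₁ e₂ e₃ f₁ : R) :
    hqtB₂_lamB α η γ A N M e₁ e₂ e₃ f₁ = hqtB₂_certB α η (1 - α - η) γ (1 - γ) A (N - f₁) f₁ (M - e₁) e₁ e₂ e₃ := by
  simp only [hqtB₂_lamB, hqtB₂_certB]
  ring

end Algebra

/-! ## Signs over `ℝ` -/

section Real

/-- The certificate `hqtB₁_certA` is nonnegative when its (used) arguments are. [this work] -/
theorem hqtB₁_certA_nonneg {α η ρ γ γ' A u f₁ v e₁ e₂ e₃ C₁ C₂ : ℝ} (hα : 0 ≤ α) (hη : 0 ≤ η) (hρ : 0 ≤ ρ) (hγ : 0 ≤ γ) (hγ' : 0 ≤ γ') (hv : 0 ≤ v) (he₁ : 0 ≤ e₁) (he₂ : 0 ≤ e₂) (he₃ : 0 ≤ e₃) (hC₁ : 0 ≤ C₁) (hC₂ : 0 ≤ C₂) :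
    0 ≤ hqtB₁_certA α η ρ γ γ' A u f₁ v e₁ e₂ e₃ C₁ C₂ := by
  unfold hqtB₁_certA
  positivity

/-- **`Λ_A ≥ 0` for the `H_{q+t}` first piece**: first-order nonnegativity of `hqtB₁` at `V3` along the attachment direction, from the two HARRIS covariances `C₁ ≥ 0` (in `G₁`) and `C₂ ≥ 0` (in `G₁/{a=y}`) of the hidden attachment vertex `w` and the atom signs. [this work] -/
theorem hqtB₁_lamA_nonneg {α η γ A N M e₁ e₂ e₃ f₁ : ℝ} (hα : 0 ≤ α) (hη : 0 ≤ η) (hρ : α + η ≤ 1) (hγ : 0 ≤ γ) (hγ1 : γ ≤ 1) (hM : e₁ ≤ M) (he₁ : 0 ≤ e₁) (he₂ : 0 ≤ e₂) (he₃ : 0 ≤ e₃)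
    (hC₁ : 0 ≤ (1 - α) * A - α * N - α * M) (hC₂ : 0 ≤ (1 - α - η) * (A + f₁ + e₁ + e₃) - (α + η) * (N - f₁) - (α + η) * (M - e₁ + e₂)) :
    0 ≤ hqtB₁_lamA α η γ A N M e₁ e₂ e₃ f₁ := by
  rw [hqtB₁_lamA_eq_cert]
  exact hqtB₁_certA_nonneg hα hη (by linarith) hγ (by linarith) (by linarith) he₁ he₂ he₃ hC₁ hC₂

/-- The certificate `hqtB₁_certB` is nonnegative when its (used) arguments are. [this work] -/
theorem hqtB₁_certB_nonneg {α η ρ γ γ' A u f₁ v e₁ e₂ e₃ : ℝ} (hα : 0 ≤ α) (hη : 0 ≤ η) (hρ : 0 ≤ ρ) (hγ : 0 ≤ γ) (hγ' : 0 ≤ γ') (hv : 0 ≤ v) (he₁ : 0 ≤ e₁) (he₂ : 0 ≤ e₂) :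
    0 ≤ hqtB₁_certB α η ρ γ γ' A u f₁ v e₁ e₂ e₃ := by
  unfold hqtB₁_certB
  positivity

/-- **`Λ_B ≥ 0` for the `H_{q+t}` first piece** (merge direction; no covariance needed). [this work] -/
theorem hqtB₁_lamB_nonneg {α η γ A N M e₁ e₂ e₃ f₁ : ℝ} (hα : 0 ≤ α) (hη : 0 ≤ η) (hρ : α + η ≤ 1) (hγ : 0 ≤ γ) (hγ1 : γ ≤ 1) (hM : e₁ ≤ M) (he₁ : 0 ≤ e₁) (he₂ : 0 ≤ e₂) :
    0 ≤ hqtB₁_lamB α η γ A N M e₁ e₂ e₃ f₁ := by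
  rw [hqtB₁_lamB_eq_cert]
  exact hqtB₁_certB_nonneg hα hη (by linarith) hγ (by linarith) (by linarith) he₁ he₂

/-- **General elementary identification `w ~ w′`**: the division-free first-order derivative `ρ'·Λ_A + (κ₂(1−γ) − γ(κ₁+ρ'))·Λ_B` of `hqtB₁` is nonnegative whenever the `(b,w′,c)` law of `G₂` satisfies AG (`κ₂(1−γ) − γ(κ₁+ρ') ≥ κ₁ρ' ≥ 0`, van den Berg–Kesten / Gladkov) — taken here as the hypothesis `hAG`. [this work] -/
theorem hqtB₁_derivative_comb_nonneg {α η γ A N M e₁ e₂ e₃ f₁ ρ' κ₁ κ₂ : ℝ} (hα : 0 ≤ α) (hη : 0 ≤ η) (hρ : α + η ≤ 1) (hγ : 0 ≤ γ) (hγ1 : γ ≤ 1) (hM : e₁ ≤ M) (he₁ : 0 ≤ e₁) (he₂ : 0 ≤ e₂) (he₃ : 0 ≤ e₃)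
    (hC₁ : 0 ≤ (1 - α) * A - α * N - α * M) (hC₂ : 0 ≤ (1 - α - η) * (A + f₁ + e₁ + e₃) - (α + η) * (N - f₁) - (α + η) * (M - e₁ + e₂))
    (hρ' : 0 ≤ ρ') (hAG : 0 ≤ κ₂ * (1 - γ) - γ * (κ₁ + ρ')) :
    0 ≤ ρ' * hqtB₁_lamA α η γ A N M e₁ e₂ e₃ f₁ + (κ₂ * (1 - γ) - γ * (κ₁ + ρ')) * hqtB₁_lamB α η γ A N M e₁ e₂ e₃ f₁ :=
  add_nonneg (mul_nonneg hρ' (hqtB₁_lamA_nonneg hα hη hρ hγ hγ1 hM he₁ he₂ he₃ hC₁ hC₂))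
    (mul_nonneg hAG (hqtB₁_lamB_nonneg hα hη hρ hγ hγ1 hM he₁ he₂))

/-- The certificate `hqtB₂_certA` is nonnegative when its (used) arguments are. [this work] -/
theorem hqtB₂_certA_nonneg {α η ρ γ γ' A u f₁ v e₁ e₂ e₃ C₁ C₂ : ℝ} (hα : 0 ≤ α) (hη : 0 ≤ η) (hρ : 0 ≤ ρ) (hγ : 0 ≤ γ) (hγ' : 0 ≤ γ') (hv : 0 ≤ v) (he₁ : 0 ≤ e₁) (he₂ : 0 ≤ e₂) (he₃ : 0 ≤ e₃) (hC₁ : 0 ≤ C₁) (hC₂ : 0 ≤ C₂) :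
    0 ≤ hqtB₂_certA α η ρ γ γ' A u f₁ v e₁ e₂ e₃ C₁ C₂ := by
  unfold hqtB₂_certA
  positivity

/-- **`Λ_A ≥ 0` for the `H_{q+t}` second piece**: first-order nonnegativity of `hqtB₂` at `V3` along the attachment direction, from the two HARRIS covariances `C₁ ≥ 0` (in `G₁`) and `C₂ ≥ 0` (in `G₁/{a=y}`) of the hidden attachment vertex `w` and the atom signs. [this work] -/
theorem hqtB₂_lamA_nonneg {α η γ A N M e₁ e₂ e₃ f₁ : ℝ} (hα : 0 ≤ α) (hη : 0 ≤ η) (hρ : α + η ≤ 1) (hγ : 0 ≤ γ) (hγ1 : γ ≤ 1) (hM : e₁ ≤ M) (he₁ : 0 ≤ e₁) (he₂ : 0 ≤ e₂) (he₃ : 0 ≤ e₃)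
    (hC₁ : 0 ≤ (1 - α) * A - α * N - α * M) (hC₂ : 0 ≤ (1 - α - η) * (A + f₁ + e₁ + e₃) - (α + η) * (N - f₁) - (α + η) * (M - e₁ + e₂)) :
    0 ≤ hqtB₂_lamA α η γ A N M e₁ e₂ e₃ f₁ := by
  rw [hqtB₂_lamA_eq_cert]
  exact hqtB₂_certA_nonneg hα hη (by linarith) hγ (by linarith) (by linarith) he₁ he₂ he₃ hC₁ hC₂

/-- The certificate `hqtB₂_certB` is nonnegative when its (used) arguments are. [this work] -/
theorem hqtB₂_certB_nonneg {α η ρ γ γ' A u f₁ v e₁ e₂ e₃ : ℝ} (hα : 0 ≤ α) (hη : 0 ≤ η) (hρ : 0 ≤ ρ) (hγ : 0 ≤ γ) (hγ' : 0 ≤ γ') (hv : 0 ≤ v) (he₁ : 0 ≤ e₁) (he₂ : 0 ≤ e₂) :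
    0 ≤ hqtB₂_certB α η ρ γ γ' A u f₁ v e₁ e₂ e₃ := by
  unfold hqtB₂_certB
  positivity

/-- **`Λ_B ≥ 0` for the `H_{q+t}` second piece** (merge direction; no covariance needed). [this work] -/
theorem hqtB₂_lamB_nonneg {α η γ A N M e₁ e₂ e₃ f₁ : ℝ} (hα : 0 ≤ α) (hη : 0 ≤ η) (hρ : α + η ≤ 1) (hγ : 0 ≤ γ) (hγ1 : γ ≤ 1) (hM : e₁ ≤ M) (he₁ : 0 ≤ e₁) (he₂ : 0 ≤ e₂) :
    0 ≤ hqtB₂_lamB α η γ A N M e₁ e₂ e₃ f₁ := by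
  rw [hqtB₂_lamB_eq_cert]
  exact hqtB₂_certB_nonneg hα hη (by linarith) hγ (by linarith) (by linarith) he₁ he₂

/-- **General elementary identification `w ~ w′`**: the division-free first-order derivative `ρ'·Λ_A + (κ₂(1−γ) − γ(κ₁+ρ'))·Λ_B` of `hqtB₂` is nonnegative whenever the `(b,w′,c)` law of `G₂` satisfies AG (`κ₂(1−γ) − γ(κ₁+ρ') ≥ κ₁ρ' ≥ 0`, van den Berg–Kesten / Gladkov) — taken here as the hypothesis `hAG`. [this work] -/
theorem hqtB₂_derivative_comb_nonneg {α η γ A N M e₁ e₂ e₃ f₁ ρ' κ₁ κ₂ : ℝ} (hα : 0 ≤ α) (hη : 0 ≤ η) (hρ : α + η ≤ 1) (hγ : 0 ≤ γ) (hγ1 : γ ≤ 1) (hM : e₁ ≤ M) (he₁ : 0 ≤ e₁) (he₂ : 0 ≤ e₂) (he₃ : 0 ≤ e₃)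
    (hC₁ : 0 ≤ (1 - α) * A - α * N - α * M) (hC₂ : 0 ≤ (1 - α - η) * (A + f₁ + e₁ + e₃) - (α + η) * (N - f₁) - (α + η) * (M - e₁ + e₂))
    (hρ' : 0 ≤ ρ') (hAG : 0 ≤ κ₂ * (1 - γ) - γ * (κ₁ + ρ')) :
    0 ≤ ρ' * hqtB₂_lamA α η γ A N M e₁ e₂ e₃ f₁ + (κ₂ * (1 - γ) - γ * (κ₁ + ρ')) * hqtB₂_lamB α η γ A N M e₁ e₂ e₃ f₁ :=
  add_nonneg (mul_nonneg hρ' (hqtB₂_lamA_nonneg hα hη hρ hγ hγ1 hM he₁ he₂ he₃ hC₁ hC₂))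
    (mul_nonneg hAG (hqtB₂_lamB_nonneg hα hη hρ hγ hγ1 hM he₁ he₂))

end Real

end Summit.CriticalPhenomena.PercolationContinuityZ3.Theorems.TerminalEdgeStep.CutVertexFirstOrder
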